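import Summits.QuantumFields.BalabanUV.Gaps.D1PinnedPositionTableAffine

/-!
# D1 (pinned family) — FINITELY MANY POSITION TABLES DECIDE (D1) IN THE TABLE DIRECTION, HYPOTHESIS-FREE at the pin

Census row 80 of `HOME/g1/RESIDUE.md` (the «382 members» recipe, table part).  For fixed root, colour triple, border weight, numeral and channel, the table response
`Tc ↦ lim β⁰(r, c⃗; cB, Tc)` is AFFINE (`D1PinnedPositionTableAffine.lim_JsBalAn1_table_add ∕ _smul`), so (D1) — the equation `lim β⁰ = stepBal N Lc` (g1-p3's
`d1Drift_pinned_iff_lim_eq`) — propagates from `Tc = 0` and a finite family `E i` to every finite linear combination `Σ aᵢ • E i` (**`d1Drift_table_span`**); with ANY basis of the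
(256-dimensional) real vector space of position tables `Fin 4 → Fin 4 → Fin 4 → Fin 4 → ℝ` this gives **`d1Drift_table_of_finBasis`**: (D1) at `Tc = 0` and at the `finrank` basis tables
⟹ (D1) at EVERY position table.  CONTENT: all [folklore]; 0 def, 0 sorry; built imports only.

Provenance: cell pub-balaban-gaps, seat g1-p1 GEN 12 (prover-pub-balaban-gaps-g1-p1-g12-0), 2026-08-24.  HONEST FRAMING: [folklore] kernel algebra BY NAME over tree theorems;
NOTHING of Bałaban's asserted ([Balaban1987RG1] Thm 2 is UNPROVED IN PRINT); NO coefficient computed or signed; binder (D1) of B12 Thm 2 at the β-lead's pinned literal is NOT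
discharged; NOT `BetaPertH`, NOT continuum, NOT Clay.
-/

noncomputable section

open Finset
open scoped BigOperators
open Literature.MathematicalPhysics.QuantumFieldTheory Balaban1983to89 Balaban1983to89.Beta
open OneStepKernelFamily (TbalOf D1Drift)
open AffineAveraging (box toSite)
open RateCertificate (CauchyRate)
open Summit.QuantumFields.BalabanUV.Beta.MixedJetTablesPlug (JsBalAn1)
open Summit.QuantumFields.BalabanUV.Beta.GAN24.StencilSlotOfE3 (one_le_of_two_le)
open Summit.QuantumFields.BalabanUV.Gaps.CapTailPinnedLimitSign (d1Drift_pinned_iff_lim_eq)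
open Summit.QuantumFields.BalabanUV.Gaps.D1PinnedPositionTableAffine (lim_JsBalAn1_table_add lim_JsBalAn1_table_smul)

namespace Summit.QuantumFields.BalabanUV.Gaps.D1PinnedTableSpanDecision

variable {Lc : ℕ} [NeZero Lc] {r : Fin (3 + 1) → ℕ}

/-- [folklore] **(D1) PROPAGATES ALONG FINITE LINEAR COMBINATIONS OF POSITION TABLES, HYPOTHESIS-FREE** (fixed root, colour triple, `cB`, numeral, channel): if the drift criterion holds at
`Tc = 0` and at every table `E i`, `i ∈ s`, then it holds at `Σ_{i ∈ s} aᵢ • E i` for all real coefficients (`lim_JsBalAn1_table_add ∕ _smul`, `Finset` induction). -/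
theorem d1Drift_table_span {ι : Type*} (hLc : 2 ≤ Lc) (hr : r ∈ box (3 + 1) Lc) (cE cVH cΛ cB : ℝ) (μ ν : Fin 4) (N : ℝ)
    (E : ι → (Fin 4 → Fin 4 → Fin 4 → Fin 4 → ℝ)) (a : ι → ℝ) (s : Finset ι)
    (h0 : D1Drift Lc (JsBalAn1 (one_le_of_two_le hLc) hr cE cVH cΛ ((Lc : ℝ) ^ (2 * (3 + 1))) cB 0) N μ ν)
    (hE : ∀ i ∈ s, D1Drift Lc (JsBalAn1 (one_le_of_two_le hLc) hr cE cVH cΛ ((Lc : ℝ) ^ (2 * (3 + 1))) cB (E i)) N μ ν) :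
    D1Drift Lc (JsBalAn1 (one_le_of_two_le hLc) hr cE cVH cΛ ((Lc : ℝ) ^ (2 * (3 + 1))) cB (∑ i ∈ s, a i • E i)) N μ ν := by
  classical
  rw [d1Drift_pinned_iff_lim_eq hLc hr] at h0
  induction s using Finset.induction_on with
  | empty => rw [Finset.sum_empty]; exact (d1Drift_pinned_iff_lim_eq hLc hr _ _ _ cB _ μ ν N).mpr h0
  | insert i s hi IH =>
    have hEi := (d1Drift_pinned_iff_lim_eq hLc hr _ _ _ cB _ μ ν N).mp (hE i (Finset.mem_insert_self i s))
    have hS := (d1Drift_pinned_iff_lim_eq hLc hr _ _ _ cB _ μ ν N).mp (IH fun k hk => hE k (Finset.mem_insert_of_mem hk))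
    rw [d1Drift_pinned_iff_lim_eq hLc hr, Finset.sum_insert hi]
    have hadd := lim_JsBalAn1_table_add hLc hr cE cVH cΛ cB (a i • E i) (∑ k ∈ s, a k • E k) μ ν
    have hsm := lim_JsBalAn1_table_smul hLc hr cE cVH cΛ cB (E i) (a i) μ ν
    rw [hsm, hS, h0, hEi] at hadd
    linear_combination hadd

/-- [folklore] **FINITELY MANY POSITION TABLES DECIDE (D1) IN THE TABLE DIRECTION, HYPOTHESIS-FREE**: with `b` = Mathlib's `Module.finBasis` of the real vector space of position tables
(`finrank = 4⁴ = 256`), (D1) at `Tc = 0` and at the basis tables `b i` ⟹ (D1) at EVERY position table (same root, colour triple, `cB`, numeral, channel) — `Basis.sum_repr` +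
`d1Drift_table_span`. -/
theorem d1Drift_table_of_finBasis (hLc : 2 ≤ Lc) (hr : r ∈ box (3 + 1) Lc) (cE cVH cΛ cB : ℝ) (μ ν : Fin 4) (N : ℝ)
    (h0 : D1Drift Lc (JsBalAn1 (one_le_of_two_le hLc) hr cE cVH cΛ ((Lc : ℝ) ^ (2 * (3 + 1))) cB 0) N μ ν)
    (hb : ∀ i, D1Drift Lc (JsBalAn1 (one_le_of_two_le hLc) hr cE cVH cΛ ((Lc : ℝ) ^ (2 * (3 + 1))) cB
      (Module.finBasis ℝ (Fin 4 → Fin 4 → Fin 4 → Fin 4 → ℝ) i)) N μ ν)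
    (Tc : Fin 4 → Fin 4 → Fin 4 → Fin 4 → ℝ) :
    D1Drift Lc (JsBalAn1 (one_le_of_two_le hLc) hr cE cVH cΛ ((Lc : ℝ) ^ (2 * (3 + 1))) cB Tc) N μ ν := by
  set b := Module.finBasis ℝ (Fin 4 → Fin 4 → Fin 4 → Fin 4 → ℝ) with hbdef
  have e : Tc = ∑ i ∈ Finset.univ, b.repr Tc i • b i := (b.sum_repr Tc).symm
  rw [e]
  exact d1Drift_table_span hLc hr cE cVH cΛ cB μ ν N b (fun i => b.repr Tc i) Finset.univ h0 fun i _ => hb i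

/-- [folklore] The dimension count: the real vector space of position tables has `finrank = 256`, so `d1Drift_table_of_finBasis` uses 256 basis tables (+ the zero table). -/
theorem finrank_tables : Module.finrank ℝ (Fin 4 → Fin 4 → Fin 4 → Fin 4 → ℝ) = 256 := by
  simp only [Module.finrank_pi_fintype, Fintype.card_fin, Finset.sum_const, Finset.card_univ, smul_eq_mul, Module.finrank_self]

end Summit.QuantumFields.BalabanUV.Gaps.D1PinnedTableSpanDecision

end
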